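/-
Copyright (c) 2026 the pub-hodgecm-mathlib formalisation cell (harness21).  Prover seat hodgecm-mathlib-F0P2-p01 (g19) (supports-only lane of crux H413 =
stmt-HodgeConjecture-24833; §0 DEFAULT «bare-letter discharge»), 2026-09-02.
-/
import Literature.NumberTheory.Rogawski1990.LocalTransferAtOneTameRamifiedLevelOneClosed      -- ★ (F0P3-p02 (g17)) the «S3-ram» contract `s3res_tame_of_shalika_of_rankRam_of_levelOne_of_det`, UNCONDITIONAL
import Literature.NumberTheory.Rogawski1990.LocalTransferIdentityCoreResidualStatementsSplit   -- ★ p848000 (LH4-p01 (g0)) `n6nsS3id_of_statements` over the three letters of ★ p847938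
import Literature.NumberTheory.Rogawski1990.ShalikaGermExpansionUnitaryThreeNonsplitCM         -- ★ p850530 (LH10-p01 (g3)) ED. 3: `n6nsShalikaStatement_holds`, `shalikaGermExpansionNonsplit_antidiagOne_three`
import HarnessLib

/-!
# [Rogawski1990 §8.1 Props. 8.1.1–8.1.2; §4.9 Prop. 4.9.1 (a)] The «S3-ram at `Φ₃`» letter DISCHARGED, its Shalika-free form, and the identity core of local
# `Δ‴`-transfer at every non-split place modulo the single dyadic residual

HONEST LABEL: HC_CM is proved only modulo the 7 printed citations (2 remaining: hLiu418 = stmt-HodgeConjecture-24832, h413 = stmt-HodgeConjecture-24833) until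
rung 0 closes.  Literature THEOREMS file (no `def`, no `instance`, no `sorry`), cell `pub/hodgecm-mathlib`, crux H413, line LH4 ∕ germ road «N6nsGerm»; count-neutral
for the books (the germ line's `stub_N6nsS3ram` is already paid by the same term; the dyadic row [LS₂ at `v ∣ 2`] is untouched).

WHAT THIS MODULE DOES.  The statements file ★ `LocalTransferIdentityCoreResidualStatements` (p847938) froze the three residuals of the identity core `stub_N6nsS3id`
as bare constants `N6nsS3ramStatement` («S3-ram at `Φ₃`», flagged «IN-HOUSE PAYABLE»), `N6nsDyadicStatement` («DYADIC», print [LS₂]) and `N6nsShalikaStatement`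
(«Shalika at `Φ₃`»), and ★ `n6nsS3id_of_statements` (p848000) re-exported the three-way split over them.  Since then two of the three became theorems of the
tree: «Shalika at `Φ₃`» at EVERY non-split place (★ `n6nsShalikaStatement_holds`, ED. 3 of `ShalikaGermExpansionUnitaryThreeNonsplitCM`) and the tame-ramified
contract ★ `s3res_tame_of_shalika_of_rankRam_of_levelOne_of_det` (`LocalTransferAtOneTameRamifiedLevelOneClosed`, unconditional).  Here:
* §1 `n6nsS3ramStatement_holds : N6nsS3ramStatement` — the letter, by the contract at `H′ := Φ₃ = antidiag(1,1,1)` (★ `antidiagOne_isHermitian`,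
  ★ `isUnit_placeForm_antidiagOne`, ★ `unit_placeForm_antidiagOne_mem_glInt`, ★ `isUnit_antidiagOne_det`) — the SAME term that pays the germ's `stub_N6nsS3ram`;
* §2 `n6nsS3ram_antidiagOne_three` — the letter's text with its Shalika hypothesis line DROPPED: the identity core of local `Δ‴_v`-transfer for the quasi-split
  `U(Φ₃)` at a TAMELY RAMIFIED non-split place with `2 ∈ 𝒪_w^×`, HYPOTHESIS-FREE (Shalika from ★ `UnitaryGroup.shalikaGermExpansionNonsplit_antidiagOne_three`,
  the place being non-split by ★ `PlacesOver.subsingleton_of_smul_eq`);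
* §3 `n6nsS3id_of_dyadic (hdy : N6nsDyadicStatement)` — ★ `n6nsS3id_of_statements` with its first and third letters discharged: the identity core at EVERY
  non-split place `v` of `L⁺`, for EVERY anisotropic hermitian `H′ ∈ M₃(L)` and every `μ` under the μ-guard, modulo the ONE print residual «[LS₂] at `v ∣ 2`».

## References
* [Rogawski1990] J. D. Rogawski, *Automorphic Representations of Unitary Groups in Three Variables*, Ann. of Math. Stud. 123 (1990): §4.9 Prop. 4.9.1 (a) p. 55;
  §8.1 Props. 8.1.1–8.1.2 pp. 112–114; §14.4 p. 237.
* [LanglandsShelstad1990Descent] R. P. Langlands, D. Shelstad, *Descent for transfer factors*, The Grothendieck Festschrift II, Progr. Math. 87 (1990): §2.1 (2.1.2).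
* [LanglandsShelstad1989] R. P. Langlands, D. Shelstad, *Orbital integrals on forms of SL(3), II*, Canad. J. Math. 41 (1989): Theorem (end of §2, p. 484) (= [LS₂]).
-/

set_option autoImplicit false

noncomputable section

open NumberField IsDedekindDomain MeasureTheory Measure Topology Filter
open Literature.NumberTheory.Rogawski1990 Literature.NumberTheory.Automorphic Literature.NumberTheory.GaloisRepresentations
open Literature.NumberTheory.Automorphic.UnitaryGroup Literature.NumberTheory.Automorphic.IntegralReduction
open Literature.AlgebraicGeometry.ShimuraVarieties (unitaryGroup hermForm)
open scoped Matrix MatrixGroups Classical ValuativeRel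

namespace Literature.NumberTheory.Rogawski1990

/-! ## §1 The «S3-ram at `Φ₃`» letter is a theorem -/

/-- **«S3-RAM AT `Φ₃`» HOLDS** — the bare print letter `N6nsS3ramStatement` (the identity core of local `Δ‴_v`-transfer for the quasi-split `U(Φ₃)(L⁺_v)` at a
tamely ramified non-split place with `2 ∈ 𝒪_w^×`, GIVEN the Shalika germ expansion, for CANONICAL orbital families) is a theorem of the tree: the unconditional
contract ★ `s3res_tame_of_shalika_of_rankRam_of_levelOne_of_det` at `H′ := Φ₃` (hermitian ★ `antidiagOne_isHermitian`; `placeForm Φ₃ w` a unit in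
`GL₃(𝒪_w)` ★ `isUnit_placeForm_antidiagOne` ∕ `unit_placeForm_antidiagOne_mem_glInt`; `det Φ₃ ≠ 0` ★ `isUnit_antidiagOne_det`).  Same term as the germ line's
paid `stub_N6nsS3ram`.  [cite: Rogawski1990, §8.1 Props. 8.1.1–8.1.2 pp. 112–114; §4.9 Prop. 4.9.1 (a) p. 55] [cite: LanglandsShelstad1990Descent, §2.1 (2.1.2)] -/
theorem n6nsS3ramStatement_holds : N6nsS3ramStatement := by
  intro L _ _ _ μ v w hw he hμu hμω h2 _ _ _ _ _ _ _ _ νH _ _ νG₃ _ _ mH mG₃ hmH hmG₃ hSh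
  exact s3res_tame_of_shalika_of_rankRam_of_levelOne_of_det L (Matrix.of fun i j : Fin 3 => if i.val + j.val + 1 = 3 then (1 : L) else 0) μ
    (UnitaryGroup.antidiagOne_isHermitian L 3) w hw he (UnitaryGroup.isUnit_placeForm_antidiagOne 3 w.1)
    (UnitaryGroup.unit_placeForm_antidiagOne_mem_glInt 3 w.1) hμu hμω h2 νH νG₃ hmH hmG₃
    (UnitaryGroup.isUnit_antidiagOne_det L 3).ne_zero hSh

/-! ## §2 The Shalika-free form: «S3-ram at `Φ₃`» hypothesis-free -/

/-- **«S3-RAM AT `Φ₃`», HYPOTHESIS-FREE** — the text of `N6nsS3ramStatement` with its Shalika hypothesis line dropped: for a CM field `L`, a unitary Hecke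
character `μ` with `μ|_{𝕀_{L⁺}} = ω_{L∕L⁺}`, a non-split place `v` of `L⁺` with `w ∣ v`, `c • w = w`, `e(w|v) ≠ 1` and `2 ∈ 𝒪_w^×`, Borel σ-algebras, Haar
measures and CANONICAL orbital families `mH`, `mG₃` on `H_v = U(1,1) × U(1)` and `G′_v = U(Φ₃)(L⁺_v)`: every `φ₃ ∈ C_c^∞(G′_v)` admits `V ∈ 𝓝 1` and
`φH ∈ C_c^∞(H_v)` with `SO_{γH}(φH) = Σ_c Δ‴_v(γH, c)·O_c(φ₃)` for all `G`-regular `γH ∈ V`.  Proof: §1, the Shalika germ expansion being ★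
`UnitaryGroup.shalikaGermExpansionNonsplit_antidiagOne_three` (in-house, every non-split place; `Subsingleton (PlacesOver L v)` by ★ `PlacesOver.subsingleton_of_smul_eq`).
[cite: Rogawski1990, §8.1 Props. 8.1.1–8.1.2 pp. 112–114; §4.9 Prop. 4.9.1 (a) p. 55] [cite: LanglandsShelstad1990Descent, §2.1 (2.1.2)] -/
theorem n6nsS3ram_antidiagOne_three :
    ∀ (L : Type) [Field L] [NumberField L] [IsCMField L] (μ : HeckeCharacter L)
      {v : HeightOneSpectrum (𝓞 ↥(maximalRealSubfield L))} (w : UnitaryGroup.PlacesOver L v)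
      (_hw : IsCMField.complexConj L • w.1 = w.1) (_he : v.asIdeal.ramificationIdx' w.1.asIdeal ≠ 1)
      (_hμu : μ.IsUnitary)
      (_hμω : ∀ x : ideleGroup ↥(maximalRealSubfield L), μ (AdeleRing.ideleBaseChange ↥(maximalRealSubfield L) L x) = quadraticHeckeCharCM L x)
      (_h2 : IsUnit (2 : 𝒪[w.1.adicCompletion L]))
      [MeasurableSpace ((UnitaryGroup.cmDatum L 3 (Matrix.of fun i j : Fin 3 => if i.val + j.val + 1 = 3 then (1 : L) else 0)).Local v)] [BorelSpace ((UnitaryGroup.cmDatum L 3 (Matrix.of fun i j : Fin 3 => if i.val + j.val + 1 = 3 then (1 : L) else 0)).Local v)]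
      [∀ γ : ((UnitaryGroup.cmDatum L 3 (Matrix.of fun i j : Fin 3 => if i.val + j.val + 1 = 3 then (1 : L) else 0)).Local v), MeasurableSpace (((UnitaryGroup.cmDatum L 3 (Matrix.of fun i j : Fin 3 => if i.val + j.val + 1 = 3 then (1 : L) else 0)).Local v) ⧸ Subgroup.centralizer ({γ} : Set ((UnitaryGroup.cmDatum L 3 (Matrix.of fun i j : Fin 3 => if i.val + j.val + 1 = 3 then (1 : L) else 0)).Local v)))]
      [∀ γ : ((UnitaryGroup.cmDatum L 3 (Matrix.of fun i j : Fin 3 => if i.val + j.val + 1 = 3 then (1 : L) else 0)).Local v), BorelSpace (((UnitaryGroup.cmDatum L 3 (Matrix.of fun i j : Fin 3 => if i.val + j.val + 1 = 3 then (1 : L) else 0)).Local v) ⧸ Subgroup.centralizer ({γ} : Set ((UnitaryGroup.cmDatum L 3 (Matrix.of fun i j : Fin 3 => if i.val + j.val + 1 = 3 then (1 : L) else 0)).Local v)))]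
      [MeasurableSpace ((UnitaryGroup.cmDatum L 2 (Matrix.of fun i j : Fin 2 => if i.val + j.val + 1 = 2 then (1 : L) else 0)).Local v × (UnitaryGroup.cmDatum L 1 (Matrix.of fun i j : Fin 1 => if i.val + j.val + 1 = 1 then (1 : L) else 0)).Local v)] [BorelSpace ((UnitaryGroup.cmDatum L 2 (Matrix.of fun i j : Fin 2 => if i.val + j.val + 1 = 2 then (1 : L) else 0)).Local v × (UnitaryGroup.cmDatum L 1 (Matrix.of fun i j : Fin 1 => if i.val + j.val + 1 = 1 then (1 : L) else 0)).Local v)]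
      [∀ a : ((UnitaryGroup.cmDatum L 2 (Matrix.of fun i j : Fin 2 => if i.val + j.val + 1 = 2 then (1 : L) else 0)).Local v × (UnitaryGroup.cmDatum L 1 (Matrix.of fun i j : Fin 1 => if i.val + j.val + 1 = 1 then (1 : L) else 0)).Local v), MeasurableSpace (((UnitaryGroup.cmDatum L 2 (Matrix.of fun i j : Fin 2 => if i.val + j.val + 1 = 2 then (1 : L) else 0)).Local v × (UnitaryGroup.cmDatum L 1 (Matrix.of fun i j : Fin 1 => if i.val + j.val + 1 = 1 then (1 : L) else 0)).Local v) ⧸ Subgroup.centralizer ({a} : Set ((UnitaryGroup.cmDatum L 2 (Matrix.of fun i j : Fin 2 => if i.val + j.val + 1 = 2 then (1 : L) else 0)).Local v × (UnitaryGroup.cmDatum L 1 (Matrix.of fun i j : Fin 1 => if i.val + j.val + 1 = 1 then (1 : L) else 0)).Local v)))]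
      [∀ a : ((UnitaryGroup.cmDatum L 2 (Matrix.of fun i j : Fin 2 => if i.val + j.val + 1 = 2 then (1 : L) else 0)).Local v × (UnitaryGroup.cmDatum L 1 (Matrix.of fun i j : Fin 1 => if i.val + j.val + 1 = 1 then (1 : L) else 0)).Local v), BorelSpace (((UnitaryGroup.cmDatum L 2 (Matrix.of fun i j : Fin 2 => if i.val + j.val + 1 = 2 then (1 : L) else 0)).Local v × (UnitaryGroup.cmDatum L 1 (Matrix.of fun i j : Fin 1 => if i.val + j.val + 1 = 1 then (1 : L) else 0)).Local v) ⧸ Subgroup.centralizer ({a} : Set ((UnitaryGroup.cmDatum L 2 (Matrix.of fun i j : Fin 2 => if i.val + j.val + 1 = 2 then (1 : L) else 0)).Local v × (UnitaryGroup.cmDatum L 1 (Matrix.of fun i j : Fin 1 => if i.val + j.val + 1 = 1 then (1 : L) else 0)).Local v)))]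
      (νH : Measure ((UnitaryGroup.cmDatum L 2 (Matrix.of fun i j : Fin 2 => if i.val + j.val + 1 = 2 then (1 : L) else 0)).Local v × (UnitaryGroup.cmDatum L 1 (Matrix.of fun i j : Fin 1 => if i.val + j.val + 1 = 1 then (1 : L) else 0)).Local v)) [νH.IsHaarMeasure] [νH.IsMulRightInvariant]
      (νG₃ : Measure ((UnitaryGroup.cmDatum L 3 (Matrix.of fun i j : Fin 3 => if i.val + j.val + 1 = 3 then (1 : L) else 0)).Local v)) [νG₃.IsHaarMeasure] [νG₃.IsMulRightInvariant]
      {mH : OrbitalMeasureFamily ((UnitaryGroup.cmDatum L 2 (Matrix.of fun i j : Fin 2 => if i.val + j.val + 1 = 2 then (1 : L) else 0)).Local v × (UnitaryGroup.cmDatum L 1 (Matrix.of fun i j : Fin 1 => if i.val + j.val + 1 = 1 then (1 : L) else 0)).Local v)} {mG₃ : OrbitalMeasureFamily ((UnitaryGroup.cmDatum L 3 (Matrix.of fun i j : Fin 3 => if i.val + j.val + 1 = 3 then (1 : L) else 0)).Local v)},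
      mH.IsCanonical (IsLocalGRegular L v) νH → mG₃.IsCanonical (fun γ => IsRegularElt (γ.val : GL (Fin 3) (UnitaryGroup.LocalRing L v))) νG₃ →
      ∀ (φ₃ : ((UnitaryGroup.cmDatum L 3 (Matrix.of fun i j : Fin 3 => if i.val + j.val + 1 = 3 then (1 : L) else 0)).Local v) → ℂ), IsLocSmooth φ₃ →
        ∃ V ∈ 𝓝 (1 : ((UnitaryGroup.cmDatum L 2 (Matrix.of fun i j : Fin 2 => if i.val + j.val + 1 = 2 then (1 : L) else 0)).Local v × (UnitaryGroup.cmDatum L 1 (Matrix.of fun i j : Fin 1 => if i.val + j.val + 1 = 1 then (1 : L) else 0)).Local v)), ∃ φH : ((UnitaryGroup.cmDatum L 2 (Matrix.of fun i j : Fin 2 => if i.val + j.val + 1 = 2 then (1 : L) else 0)).Local v × (UnitaryGroup.cmDatum L 1 (Matrix.of fun i j : Fin 1 => if i.val + j.val + 1 = 1 then (1 : L) else 0)).Local v) → ℂ, IsLocSmooth φH ∧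
          ∀ γH ∈ V, IsLocalGRegular L v γH →
            stableOrbitalIntegralRel (IsLocalStablyConjH L v) mH φH γH =
              ∑ᶠ c : ConjClasses ((UnitaryGroup.cmDatum L 3 (Matrix.of fun i j : Fin 3 => if i.val + j.val + 1 = 3 then (1 : L) else 0)).Local v), ((finExplicitCollection L (Matrix.of fun i j : Fin 3 => if i.val + j.val + 1 = 3 then (1 : L) else 0) μ (finExplicitDelta_conj_left_all L (Matrix.of fun i j : Fin 3 => if i.val + j.val + 1 = 3 then (1 : L) else 0) μ) (finExplicitDelta_conj_right_all L (Matrix.of fun i j : Fin 3 => if i.val + j.val + 1 = 3 then (1 : L) else 0) μ)) v).Δ γH (Quotient.out c) * classOrbitalIntegral mG₃ φ₃ c := by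
  intro L _ _ _ μ v w hw he hμu hμω h2 _ _ _ _ _ _ _ _ νH _ _ νG₃ _ _ mH mG₃ hmH hmG₃
  have hsub : Subsingleton (UnitaryGroup.PlacesOver L v) :=
    PlacesOver.subsingleton_of_smul_eq (IsCMField.complexConj L) (IsCMField.complexConj_ne_one L) w hw
  exact n6nsS3ramStatement_holds L μ w hw he hμu hμω h2 νH νG₃ hmH hmG₃
    (UnitaryGroup.shalikaGermExpansionNonsplit_antidiagOne_three L v w hsub)

/-! ## §3 The identity core at every non-split place, modulo the dyadic residual alone -/

/-- **THE IDENTITY CORE `stub_N6nsS3id` ⟸ «DYADIC» ALONE** — ★ `n6nsS3id_of_statements` with its «S3-ram at `Φ₃`» letter discharged by §1 and its «Shalika at `Φ₃`»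
letter by ★ `n6nsShalikaStatement_holds`: for a CM field `L`, `H′ ∈ M₃(L)` hermitian anisotropic, `μ` unitary with the μ-guard, Borel σ-algebras and Haar
measures, at EVERY non-split place `v` of `L⁺` and for CANONICAL families `mH`, `mG`: every `φ ∈ C_c^∞(G′_v)` admits `V ∈ 𝓝 1` and `φH ∈ C_c^∞(H_v)` with
`SO_{γH}(φH) = Σ_c Δ‴_v(γH, c)·O_c(φ)` for all `G`-regular `γH ∈ V` — GIVEN ONLY the dyadic residual `N6nsDyadicStatement`, which stays PRINT
([LanglandsShelstad1989, Thm. p. 484] = [LS₂] at `v ∣ 2`, via [Rogawski1990 Prop. 4.9.1 (a)]; in-house pay-down: leaf `F0_P3c_DyadicPaydown` ED. 3, organs (D-UNR) ∕ (D-RAM)).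
[cite: LanglandsShelstad1990Descent, §2.1 (2.1.2)] [cite: Rogawski1990, §8.1 Props. 8.1.1–8.1.2 pp. 112–114; §4.9 Prop. 4.9.1 (a) p. 55; §14.4 p. 237]
[cite: LanglandsShelstad1989, Theorem (end of §2, p. 484)] -/
theorem n6nsS3id_of_dyadic (hdy : N6nsDyadicStatement) :
    ∀ (L : Type) [Field L] [NumberField L] [IsCMField L] (H' : Matrix (Fin 3) (Fin 3) L) (μ : HeckeCharacter L)
      [∀ v : HeightOneSpectrum (𝓞 ↥(maximalRealSubfield L)),
        MeasurableSpace ((UnitaryGroup.cmDatum L 2 (Matrix.of fun i j : Fin 2 => if i.val + j.val + 1 = 2 then (1 : L) else 0)).Local v ×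
          (UnitaryGroup.cmDatum L 1 (Matrix.of fun i j : Fin 1 => if i.val + j.val + 1 = 1 then (1 : L) else 0)).Local v)]
      [∀ v : HeightOneSpectrum (𝓞 ↥(maximalRealSubfield L)),
        BorelSpace ((UnitaryGroup.cmDatum L 2 (Matrix.of fun i j : Fin 2 => if i.val + j.val + 1 = 2 then (1 : L) else 0)).Local v ×
          (UnitaryGroup.cmDatum L 1 (Matrix.of fun i j : Fin 1 => if i.val + j.val + 1 = 1 then (1 : L) else 0)).Local v)]
      [∀ v : HeightOneSpectrum (𝓞 ↥(maximalRealSubfield L)), MeasurableSpace ((UnitaryGroup.cmDatum L 3 H').Local v)]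
      [∀ v : HeightOneSpectrum (𝓞 ↥(maximalRealSubfield L)), BorelSpace ((UnitaryGroup.cmDatum L 3 H').Local v)]
      (νH : ∀ v : HeightOneSpectrum (𝓞 ↥(maximalRealSubfield L)),
        Measure ((UnitaryGroup.cmDatum L 2 (Matrix.of fun i j : Fin 2 => if i.val + j.val + 1 = 2 then (1 : L) else 0)).Local v ×
          (UnitaryGroup.cmDatum L 1 (Matrix.of fun i j : Fin 1 => if i.val + j.val + 1 = 1 then (1 : L) else 0)).Local v))
      (νG : ∀ v : HeightOneSpectrum (𝓞 ↥(maximalRealSubfield L)), Measure ((UnitaryGroup.cmDatum L 3 H').Local v))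
      [∀ v, (νH v).IsHaarMeasure] [∀ v, (νH v).IsMulRightInvariant] [∀ v, (νG v).IsHaarMeasure] [∀ v, (νG v).IsMulRightInvariant],
      μ.IsUnitary →
      (∀ x : ideleGroup ↥(maximalRealSubfield L), μ (AdeleRing.ideleBaseChange (↥(maximalRealSubfield L)) L x) = quadraticHeckeCharCM L x) →
      (H'.map (cmConjRingHom L)).transpose = H' →
      (∀ x : Fin 3 → L, Literature.AlgebraicGeometry.ShimuraVarieties.hermForm (cmConjRingHom L) H' x x = 0 → x = 0) →
      ∀ (v : HeightOneSpectrum (𝓞 ↥(maximalRealSubfield L))), Subsingleton (UnitaryGroup.PlacesOver L v) →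
      ∀ [_iH : ∀ a : ((UnitaryGroup.cmDatum L 2 (Matrix.of fun i j : Fin 2 => if i.val + j.val + 1 = 2 then (1 : L) else 0)).Local v × (UnitaryGroup.cmDatum L 1 (Matrix.of fun i j : Fin 1 => if i.val + j.val + 1 = 1 then (1 : L) else 0)).Local v),
          MeasurableSpace (((UnitaryGroup.cmDatum L 2 (Matrix.of fun i j : Fin 2 => if i.val + j.val + 1 = 2 then (1 : L) else 0)).Local v × (UnitaryGroup.cmDatum L 1 (Matrix.of fun i j : Fin 1 => if i.val + j.val + 1 = 1 then (1 : L) else 0)).Local v) ⧸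
            Subgroup.centralizer ({a} : Set ((UnitaryGroup.cmDatum L 2 (Matrix.of fun i j : Fin 2 => if i.val + j.val + 1 = 2 then (1 : L) else 0)).Local v × (UnitaryGroup.cmDatum L 1 (Matrix.of fun i j : Fin 1 => if i.val + j.val + 1 = 1 then (1 : L) else 0)).Local v)))]
        [_bH : ∀ a : ((UnitaryGroup.cmDatum L 2 (Matrix.of fun i j : Fin 2 => if i.val + j.val + 1 = 2 then (1 : L) else 0)).Local v × (UnitaryGroup.cmDatum L 1 (Matrix.of fun i j : Fin 1 => if i.val + j.val + 1 = 1 then (1 : L) else 0)).Local v),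
          BorelSpace (((UnitaryGroup.cmDatum L 2 (Matrix.of fun i j : Fin 2 => if i.val + j.val + 1 = 2 then (1 : L) else 0)).Local v × (UnitaryGroup.cmDatum L 1 (Matrix.of fun i j : Fin 1 => if i.val + j.val + 1 = 1 then (1 : L) else 0)).Local v) ⧸
            Subgroup.centralizer ({a} : Set ((UnitaryGroup.cmDatum L 2 (Matrix.of fun i j : Fin 2 => if i.val + j.val + 1 = 2 then (1 : L) else 0)).Local v × (UnitaryGroup.cmDatum L 1 (Matrix.of fun i j : Fin 1 => if i.val + j.val + 1 = 1 then (1 : L) else 0)).Local v)))]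
        [_iG : ∀ γ : ((UnitaryGroup.cmDatum L 3 H').Local v), MeasurableSpace (((UnitaryGroup.cmDatum L 3 H').Local v) ⧸ Subgroup.centralizer ({γ} : Set ((UnitaryGroup.cmDatum L 3 H').Local v)))]
        [_bG : ∀ γ : ((UnitaryGroup.cmDatum L 3 H').Local v), BorelSpace (((UnitaryGroup.cmDatum L 3 H').Local v) ⧸ Subgroup.centralizer ({γ} : Set ((UnitaryGroup.cmDatum L 3 H').Local v)))]
        (mH : OrbitalMeasureFamily ((UnitaryGroup.cmDatum L 2 (Matrix.of fun i j : Fin 2 => if i.val + j.val + 1 = 2 then (1 : L) else 0)).Local v × (UnitaryGroup.cmDatum L 1 (Matrix.of fun i j : Fin 1 => if i.val + j.val + 1 = 1 then (1 : L) else 0)).Local v))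
        (mG : OrbitalMeasureFamily ((UnitaryGroup.cmDatum L 3 H').Local v)),
      mH.IsCanonical (IsLocalGRegular L v) (νH v) → mG.IsCanonical (fun γ => IsRegularElt (γ.val : GL (Fin 3) (UnitaryGroup.LocalRing L v))) (νG v) →
      ∀ (φ : ((UnitaryGroup.cmDatum L 3 H').Local v) → ℂ), IsLocSmooth φ →
        ∃ V ∈ 𝓝 (1 : ((UnitaryGroup.cmDatum L 2 (Matrix.of fun i j : Fin 2 => if i.val + j.val + 1 = 2 then (1 : L) else 0)).Local v × (UnitaryGroup.cmDatum L 1 (Matrix.of fun i j : Fin 1 => if i.val + j.val + 1 = 1 then (1 : L) else 0)).Local v)), ∃ φH : ((UnitaryGroup.cmDatum L 2 (Matrix.of fun i j : Fin 2 => if i.val + j.val + 1 = 2 then (1 : L) else 0)).Local v × (UnitaryGroup.cmDatum L 1 (Matrix.of fun i j : Fin 1 => if i.val + j.val + 1 = 1 then (1 : L) else 0)).Local v) → ℂ, IsLocSmooth φH ∧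
          ∀ γH ∈ V, IsLocalGRegular L v γH →
            stableOrbitalIntegralRel (IsLocalStablyConjH L v) mH φH γH =
              ∑ᶠ c : ConjClasses ((UnitaryGroup.cmDatum L 3 H').Local v), ((finExplicitCollection L H' μ (finExplicitDelta_conj_left_all L H' μ) (finExplicitDelta_conj_right_all L H' μ)) v).Δ γH (Quotient.out c) * classOrbitalIntegral mG φ c :=
  n6nsS3id_of_statements n6nsS3ramStatement_holds hdy n6nsShalikaStatement_holds

end Literature.NumberTheory.Rogawski1990

end
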